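import Mathlib
import HarnessLib
import Summits.NavierStokesRegularity.NavierStokesRegularity.Theorems.PoloidalWindowDoorPoloidalWindowRigidityUntwistedSeparation2
import Summits.NavierStokesRegularity.NavierStokesRegularity.Theorems.PoloidalWindowDoorPoloidalWindowRigidityUntwistedBranch2b
import Summits.NavierStokesRegularity.NavierStokesRegularity.Theorems.PoloidalWindowDoorPoloidalWindowRigidityUntwistedEndgame
import Summits.NavierStokesRegularity.NavierStokesRegularity.Theorems.PoloidalWindowDoorPoloidalWindowRigidityUntwistedLocalization

/-!
# Route `PoloidalWindowDoor`, crux `PoloidalWindowRigidity` (K2, stmt-NavierStokesRegularity-19708), skeleton `lrc-jet` v5,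
# stub `stub_untwisted` — ASSEMBLY CORE: an untwisted non-degenerate germ in NS₃ normal form forces a regular apex

Cell ns-regularity-ideate, K2 lead ns-poloidal-K2-p1 (gen 6; `--supports stmt-NavierStokesRegularity-19708`, helper; UNTWISTED-NOTE §3, BRIEF-v5-bricks-v2).
THE CONTRACT FOR BRICK F2.  For a profile of the route's Type-I class, poloidal along `e₃`, one slice `s < 0`, `w := v₂(s,·)`, and an open set `U ∋ y₁` of
that slice carrying the NS₃ NORMAL FORM of an untwisted germ — structure functions `P, Λ, k, pₜ` analytic at the leaf points `(w(y), y₂)` and a field `S` with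
  `∂₂w = P(w,y₂)`,  `(K1) Λ·Δₕw + Λ_w·|∇ₕw|² + DP(P,1) = 0`,  `(V0) (1−Λ)·S = (1−Λ)·Δₕw − Λ_w·|∇ₕw|² + k`,  `(Sz) ∂₂S = P_w·S + Λ·|∇ₕw|² + pₜ`,
non-degenerate (`∇ₕw ≠ 0`, `Λ ∉ {0,1}` on `U`) — the apex is regular: `untwisted_regular_of_normalForm`.
Proof = the dichotomy of UNTWISTED-NOTE §3: if one of the Wronskians `D₁` (brick F3a), `D₃` (brick F3b) is non-zero somewhere on `U`, Cramer's rule on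
`(K1),(K1)′` resp. on the dynamic pair gives `|∇ₕw|² = a(w,y₂)`, `Δₕw = b(w,y₂)` near that point with `a, b` analytic; localized to the base plane
(brick F5c) this feeds the endgame (brick F5b, `regular_of_isoparametric_base`).  Otherwise `D₁ ≡ D₃ ≡ 0` on `U` and brick F4 (`branch2b_false_of_divIdentity`)
shows `U = ∅`, absurd.

WHAT THIS IS NOT: not the stub yet — brick F2 (the normal form for class profiles near a non-degenerate untwisted point of the window) is the remaining input
(bears_on LADDER-NS N0 via crux K2 = stmt-19708).
-/

noncomputable section

-- the summit and its single sub-problem share the name (CONVENTIONS §1), as in every Theorems file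
set_option linter.dupNamespace false

namespace Summit.NavierStokesRegularity.NavierStokesRegularity.Theorems.PoloidalWindowDoorPoloidalWindowRigidityUntwistedAssemblyCore

open Set Function Filter Topology Metric
open scoped RealInnerProductSpace InnerProductSpace
open Literature.Analysis Literature.Analysis.FluidPDE
open Summit.NavierStokesRegularity.NavierStokesRegularity.Theorems.LocalSineTubeDoorProfileAlignedWindowRigidityAncient
open Summit.NavierStokesRegularity.NavierStokesRegularity.Theorems.PoloidalWindowDoorPoloidalWindowRigidityUntwistedSeparation
open Summit.NavierStokesRegularity.NavierStokesRegularity.Theorems.PoloidalWindowDoorPoloidalWindowRigidityUntwistedSeparation2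
open Summit.NavierStokesRegularity.NavierStokesRegularity.Theorems.PoloidalWindowDoorPoloidalWindowRigidityUntwistedLogDerivatives
open Summit.NavierStokesRegularity.NavierStokesRegularity.Theorems.PoloidalWindowDoorPoloidalWindowRigidityUntwistedStuartTranslationAnalytic
open Summit.NavierStokesRegularity.NavierStokesRegularity.Theorems.PoloidalWindowDoorPoloidalWindowRigidityUntwistedBranch2b
open Summit.NavierStokesRegularity.NavierStokesRegularity.Theorems.PoloidalWindowDoorPoloidalWindowRigidityUntwistedEndgame
open Summit.NavierStokesRegularity.NavierStokesRegularity.Theorems.PoloidalWindowDoorPoloidalWindowRigidityUntwistedLocalization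

variable {C : ℝ} {v : ℝ → EuclideanSpace ℝ (Fin 3) → EuclideanSpace ℝ (Fin 3)}

/-! ### Small tools -/

/-- A coordinate box of radius `ε/2` lies in the Euclidean ball of radius `ε`. [folklore] -/
theorem box_subset_ball (y₀ : EuclideanSpace ℝ (Fin 3)) {ε : ℝ} (hε : 0 < ε) {y : EuclideanSpace ℝ (Fin 3)}
    (hy : ∀ i, |y i - y₀ i| < ε / 2) : y ∈ ball y₀ ε := by
  rw [mem_ball, EuclideanSpace.dist_eq]
  have hi : ∀ i, dist (y i) (y₀ i) ^ 2 < (ε / 2) ^ 2 := fun i => by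
    rw [Real.dist_eq]
    have h := hy i
    have h0 : 0 ≤ |y i - y₀ i| := abs_nonneg _
    nlinarith
  have hsum : ∑ i, dist (y i) (y₀ i) ^ 2 < 3 * (ε / 2) ^ 2 := by
    rw [Fin.sum_univ_three]; linarith [hi 0, hi 1, hi 2]
  calc Real.sqrt (∑ i, dist (y i) (y₀ i) ^ 2) ≤ Real.sqrt (3 * (ε / 2) ^ 2) := Real.sqrt_le_sqrt hsum.le
    _ < ε := by
        rw [Real.sqrt_lt' hε]
        nlinarith

/-- Partial-derivative functions of an analytic function of two variables are analytic. [folklore] -/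
theorem analyticAt_fderiv_apply {G : ℝ × ℝ → ℝ} {q : ℝ × ℝ} (hG : AnalyticAt ℝ G q) (u : ℝ × ℝ) :
    AnalyticAt ℝ (fun q' => fderiv ℝ G q' u) q :=
  ((ContinuousLinearMap.apply ℝ ℝ u).analyticAt _).comp hG.fderiv

/-- A function of `(w, z)` composed with a leaf quantity evaluated along `U` at fixed height: analyticity in `w` near `w(y₂)`. [folklore] -/
theorem eventually_contDiffAt_of_analyticAt {A : ℝ × ℝ → ℝ} {ω₀ z₀ : ℝ} (hA : AnalyticAt ℝ A (ω₀, z₀)) (n : ℕ∞) :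
    ∀ᶠ ω in 𝓝 ω₀, ContDiffAt ℝ n (fun ω' => A (ω', z₀)) ω := by
  have h1 : AnalyticAt ℝ (fun ω' : ℝ => A (ω', z₀)) ω₀ := hA.comp₂ analyticAt_id analyticAt_const
  filter_upwards [h1.eventually_analyticAt] with ω hω using hω.contDiffAt

/-! ### From leafwise data near one point to the endgame -/

/-- **Local leafwise data ⇒ regular apex.**  If near `y₂` (on an open `U₂`) `|∇ₕw|² = A(w,y₂)` and `Δₕw = B(w,y₂)` with `A, B` analytic at the leaf point of
`y₂`, `∂₂w = P(w,y₂)` (`P` analytic at leaf points) and `∇ₕw ≠ 0`, then the apex is regular (bricks F5c + F5b). [folklore] -/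
theorem regular_of_leafwise_near (hrate : HasTypeITimeDecay C v)
    (hcont : ContinuousOn (uncurry v) (Iio (0 : ℝ) ×ˢ univ))
    (hmild : ∀ s t : ℝ, s < t → t < 0 → ∀ x,
      v t x = UnboundedOperators.heatExtension (v s) (t - s) x - oseenDuhamel 1 s v v t x)
    (hdiv : ∀ t < 0, VectorCalculus.IsDivFree (v t))
    (hpol : ∀ s < 0, ∀ y, ⟪curl (v s) y, EuclideanSpace.single 2 1⟫_ℝ = 0)
    {s : ℝ} (hs : s < 0) {U₂ : Set (EuclideanSpace ℝ (Fin 3))} (hU₂ : IsOpen U₂) {y₂ : EuclideanSpace ℝ (Fin 3)} (hy₂ : y₂ ∈ U₂)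
    {P A B : ℝ × ℝ → ℝ}
    (hPA : ∀ y ∈ U₂, AnalyticAt ℝ P (v s y 2, y 2))
    (hP : ∀ y ∈ U₂, fderiv ℝ (fun x => v s x 2) y (EuclideanSpace.single 2 (1 : ℝ)) = P (v s y 2, y 2))
    (hnd : ∀ y ∈ U₂, fderiv ℝ (fun x => v s x 2) y (EuclideanSpace.single 0 (1 : ℝ)) ≠ 0 ∨
        fderiv ℝ (fun x => v s x 2) y (EuclideanSpace.single 1 (1 : ℝ)) ≠ 0)
    (hAan : AnalyticAt ℝ A (v s y₂ 2, y₂ 2)) (hBan : AnalyticAt ℝ B (v s y₂ 2, y₂ 2))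
    (hE : ∀ y ∈ U₂, (fderiv ℝ (fun x => v s x 2) y (EuclideanSpace.single 0 1)) ^ 2 +
        (fderiv ℝ (fun x => v s x 2) y (EuclideanSpace.single 1 1)) ^ 2 = A (v s y 2, y 2))
    (hM : ∀ y ∈ U₂, fderiv ℝ (fun y' => fderiv ℝ (fun x => v s x 2) y' (EuclideanSpace.single 0 1)) y (EuclideanSpace.single 0 1) +
        fderiv ℝ (fun y' => fderiv ℝ (fun x => v s x 2) y' (EuclideanSpace.single 1 1)) y (EuclideanSpace.single 1 1) = B (v s y 2, y 2)) :
    ¬ IsBackwardSingularPoint v 0 := by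
  set w : EuclideanSpace ℝ (Fin 3) → ℝ := fun x => v s x 2 with hw
  have hAn : AnalyticOnNhd ℝ (v s) univ := analyticOnNhd_slice hcont (bdd_of_hasTypeITimeDecay hrate) hmild hs
  have hwc : Continuous w := by
    have h1 := (EuclideanSpace.proj (2 : Fin 3) : EuclideanSpace ℝ (Fin 3) →L[ℝ] ℝ).continuous.comp hAn.continuous
    exact h1
  -- localize `A(·, z₂)` and `B(·, z₂)`
  obtain ⟨a, ha, haeq, hader⟩ := exists_contDiff_eventuallyEq (eventually_contDiffAt_of_analyticAt hAan 2)
  obtain ⟨b, hb, hbeq, -⟩ := exists_contDiff_eventuallyEq (eventually_contDiffAt_of_analyticAt hBan 1)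
  -- an open set of values where both agreements hold
  obtain ⟨Vo, hVosub, hVoo, hω₀⟩ := _root_.mem_nhds_iff.mp (haeq.and hbeq)
  -- the set `T = U₂ ∩ w⁻¹(Vo)` is an open neighbourhood of `y₂`; take a box inside
  have hTo : IsOpen (U₂ ∩ w ⁻¹' Vo) := hU₂.inter (hVoo.preimage hwc)
  have hy₂T : y₂ ∈ U₂ ∩ w ⁻¹' Vo := ⟨hy₂, hω₀⟩
  obtain ⟨ε, hε, hball⟩ := Metric.isOpen_iff.mp hTo y₂ hy₂T
  have hbox : ∀ y : EuclideanSpace ℝ (Fin 3), (∀ i, |y i - y₂ i| < ε / 2) → y ∈ U₂ ∩ w ⁻¹' Vo :=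
    fun y hy => hball (box_subset_ball y₂ hε hy)
  refine regular_of_isoparametric_base hrate hcont hmild hdiv hpol hs (y₁ := y₂) (r := ε / 2) (by positivity) (P := P)
    (fun y hy => ((hPA y (hbox y hy).1).contDiffAt).of_le le_top) (fun y hy => hP y (hbox y hy).1) (fun y hy => hnd y (hbox y hy).1)
    ha hb (fun y hy hyz => ?_) (fun y hy hyz => ?_)
  · have h := hE y (hbox y hy).1
    have hagree : a (w y) = A (w y, y₂ 2) := (hVosub (hbox y hy).2).1
    rw [h, hyz]
    exact hagree.symm
  · have h := hM y (hbox y hy).1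
    have hbgree : b (w y) = B (w y, y₂ 2) := (hVosub (hbox y hy).2).2
    rw [h, hyz]
    exact hbgree.symm

/-! ### The assembly core -/

/-- **ASSEMBLY CORE OF `stub_untwisted`: an untwisted non-degenerate germ in NS₃ normal form forces a regular apex.**  See the module docstring for the
normal form `(∂₂w = P), (K1), (V0), (Sz)`; `c = DP(·)(P,1)` throughout. [folklore] -/
theorem untwisted_regular_of_normalForm (hrate : HasTypeITimeDecay C v)
    (hcont : ContinuousOn (uncurry v) (Iio (0 : ℝ) ×ˢ univ))
    (hmild : ∀ s t : ℝ, s < t → t < 0 → ∀ x,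
      v t x = UnboundedOperators.heatExtension (v s) (t - s) x - oseenDuhamel 1 s v v t x)
    (hdiv : ∀ t < 0, VectorCalculus.IsDivFree (v t))
    (hpol : ∀ s < 0, ∀ y, ⟪curl (v s) y, EuclideanSpace.single 2 1⟫_ℝ = 0)
    {s : ℝ} (hs : s < 0) {U : Set (EuclideanSpace ℝ (Fin 3))} (hU : IsOpen U) {y₁ : EuclideanSpace ℝ (Fin 3)} (hy₁ : y₁ ∈ U)
    {P Λ k pt : ℝ × ℝ → ℝ} {S : EuclideanSpace ℝ (Fin 3) → ℝ}
    (hPA : ∀ y ∈ U, AnalyticAt ℝ P (v s y 2, y 2)) (hΛA : ∀ y ∈ U, AnalyticAt ℝ Λ (v s y 2, y 2))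
    (hkA : ∀ y ∈ U, AnalyticAt ℝ k (v s y 2, y 2)) (hptA : ∀ y ∈ U, AnalyticAt ℝ pt (v s y 2, y 2))
    (hSd : ∀ y ∈ U, DifferentiableAt ℝ S y)
    (hP : ∀ y ∈ U, fderiv ℝ (fun x => v s x 2) y (EuclideanSpace.single 2 (1 : ℝ)) = P (v s y 2, y 2))
    (hnd : ∀ y ∈ U, fderiv ℝ (fun x => v s x 2) y (EuclideanSpace.single 0 (1 : ℝ)) ≠ 0 ∨
        fderiv ℝ (fun x => v s x 2) y (EuclideanSpace.single 1 (1 : ℝ)) ≠ 0)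
    (hL0 : ∀ y ∈ U, Λ (v s y 2, y 2) ≠ 0) (hL1 : ∀ y ∈ U, Λ (v s y 2, y 2) ≠ 1)
    (hK1 : ∀ y ∈ U, Λ (v s y 2, y 2) *
        (fderiv ℝ (fun y' => fderiv ℝ (fun x => v s x 2) y' (EuclideanSpace.single 0 (1 : ℝ))) y (EuclideanSpace.single 0 (1 : ℝ)) +
          fderiv ℝ (fun y' => fderiv ℝ (fun x => v s x 2) y' (EuclideanSpace.single 1 (1 : ℝ))) y (EuclideanSpace.single 1 (1 : ℝ))) +
      fderiv ℝ Λ (v s y 2, y 2) (1, 0) *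
        (fderiv ℝ (fun x => v s x 2) y (EuclideanSpace.single 0 (1 : ℝ)) ^ 2 + fderiv ℝ (fun x => v s x 2) y (EuclideanSpace.single 1 (1 : ℝ)) ^ 2) +
        fderiv ℝ P (v s y 2, y 2) (P (v s y 2, y 2), 1) = 0)
    (hV0 : ∀ y ∈ U, (1 - Λ (v s y 2, y 2)) * S y = (1 - Λ (v s y 2, y 2)) *
        (fderiv ℝ (fun y' => fderiv ℝ (fun x => v s x 2) y' (EuclideanSpace.single 0 (1 : ℝ))) y (EuclideanSpace.single 0 (1 : ℝ)) +
          fderiv ℝ (fun y' => fderiv ℝ (fun x => v s x 2) y' (EuclideanSpace.single 1 (1 : ℝ))) y (EuclideanSpace.single 1 (1 : ℝ))) -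
      fderiv ℝ Λ (v s y 2, y 2) (1, 0) *
        (fderiv ℝ (fun x => v s x 2) y (EuclideanSpace.single 0 (1 : ℝ)) ^ 2 + fderiv ℝ (fun x => v s x 2) y (EuclideanSpace.single 1 (1 : ℝ)) ^ 2) +
        k (v s y 2, y 2))
    (hSz : ∀ y ∈ U, fderiv ℝ S y (EuclideanSpace.single 2 (1 : ℝ)) =
      fderiv ℝ P (v s y 2, y 2) (1, 0) * S y + Λ (v s y 2, y 2) *
        (fderiv ℝ (fun x => v s x 2) y (EuclideanSpace.single 0 (1 : ℝ)) ^ 2 + fderiv ℝ (fun x => v s x 2) y (EuclideanSpace.single 1 (1 : ℝ)) ^ 2) +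
        pt (v s y 2, y 2)) :
    ¬ IsBackwardSingularPoint v 0 := by
  set w : EuclideanSpace ℝ (Fin 3) → ℝ := fun x => v s x 2 with hw
  have hAn : AnalyticOnNhd ℝ (v s) univ := analyticOnNhd_slice hcont (bdd_of_hasTypeITimeDecay hrate) hmild hs
  have hwA : AnalyticOnNhd ℝ w univ := by
    have h1 := (EuclideanSpace.proj (2 : Fin 3) : EuclideanSpace ℝ (Fin 3) →L[ℝ] ℝ).comp_analyticOnNhd hAn
    exact AnalyticOnNhd.congr isOpen_univ h1 (fun y _ => by simp [hw, Function.comp])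
  have hw3 : ContDiff ℝ 3 w := hwA.contDiff
  have hw2 : ContDiff ℝ 2 w := hwA.contDiff
  have hwc : Continuous w := hw2.continuous
  have hc2 : Continuous (fun y : EuclideanSpace ℝ (Fin 3) => y 2) := (EuclideanSpace.proj (2 : Fin 3) : EuclideanSpace ℝ (Fin 3) →L[ℝ] ℝ).continuous
  have hleaf : Continuous (fun y : EuclideanSpace ℝ (Fin 3) => (w y, y 2)) := hwc.prodMk hc2
  have hP2 : ∀ y ∈ U, ContDiffAt ℝ 2 P (w y, y 2) := fun y hy => (hPA y hy).contDiffAt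
  have hΛ2 : ∀ y ∈ U, ContDiffAt ℝ 2 Λ (w y, y 2) := fun y hy => (hΛA y hy).contDiffAt
  have hPd : ∀ y ∈ U, DifferentiableAt ℝ P (w y, y 2) := fun y hy => (hP2 y hy).differentiableAt (by norm_num)
  -- the jet functions (of `q = (w, z)`)
  set Pw : ℝ × ℝ → ℝ := fun q => fderiv ℝ P q ((1 : ℝ), (0 : ℝ)) with hPw
  set Lw : ℝ × ℝ → ℝ := fun q => fderiv ℝ Λ q ((1 : ℝ), (0 : ℝ)) with hLw
  set Ld : ℝ × ℝ → ℝ := fun q => fderiv ℝ Λ q (P q, 1) with hLd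
  set cf : ℝ × ℝ → ℝ := fun q => fderiv ℝ P q (P q, 1) with hcf
  set cd : ℝ × ℝ → ℝ := fun q => fderiv ℝ cf q (P q, 1) with hcd
  set A₁ : ℝ × ℝ → ℝ := fun q => Ld q + Λ q * Pw q with hA₁
  set A₂ : ℝ × ℝ → ℝ := fun q => Λ q * fderiv ℝ Pw q ((1 : ℝ), (0 : ℝ)) + fderiv ℝ Lw q (P q, 1) + 2 * Lw q * Pw q with hA₂
  set D₁ : ℝ × ℝ → ℝ := fun q => Λ q * A₂ q - Lw q * A₁ q with hD₁
  set N : ℝ × ℝ → ℝ := fun q => Λ q * (1 - Λ q) with hN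
  set B₁ : ℝ × ℝ → ℝ := fun q => (1 - 2 * Λ q) * Ld q + N q * Pw q with hB₁
  set B₂ : ℝ × ℝ → ℝ := fun q => N q * Λ q + fderiv ℝ Lw q (P q, 1) + 2 * Lw q * Pw q with hB₂
  set D₃ : ℝ × ℝ → ℝ := fun q => N q * B₂ q - Lw q * B₁ q with hD₃
  set C₀ : ℝ × ℝ → ℝ := fun q => (1 - Λ q) * cf q - Λ q * k q with hC₀
  set kd : ℝ × ℝ → ℝ := fun q => fderiv ℝ k q (P q, 1) with hkd
  set C₁ : ℝ × ℝ → ℝ := fun q => N q * pt q + (-(Ld q) * cf q + (1 - Λ q) * cd q - Ld q * k q - Λ q * kd q) with hC₁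
  -- analyticity of all jet functions at the leaf points
  have hjet : ∀ y ∈ U, AnalyticAt ℝ Pw (w y, y 2) ∧ AnalyticAt ℝ Lw (w y, y 2) ∧ AnalyticAt ℝ Ld (w y, y 2) ∧ AnalyticAt ℝ cf (w y, y 2) ∧
      AnalyticAt ℝ cd (w y, y 2) ∧ AnalyticAt ℝ A₁ (w y, y 2) ∧ AnalyticAt ℝ A₂ (w y, y 2) ∧ AnalyticAt ℝ D₁ (w y, y 2) ∧
      AnalyticAt ℝ N (w y, y 2) ∧ AnalyticAt ℝ B₁ (w y, y 2) ∧ AnalyticAt ℝ B₂ (w y, y 2) ∧ AnalyticAt ℝ D₃ (w y, y 2) ∧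
      AnalyticAt ℝ C₀ (w y, y 2) ∧ AnalyticAt ℝ kd (w y, y 2) ∧ AnalyticAt ℝ C₁ (w y, y 2) := by
    intro y hy
    have hPa := hPA y hy; have hΛa := hΛA y hy; have hka := hkA y hy; have hpta := hptA y hy
    have hPw' : AnalyticAt ℝ Pw (w y, y 2) := analyticAt_fderiv_apply hPa _
    have hLw' : AnalyticAt ℝ Lw (w y, y 2) := analyticAt_fderiv_apply hΛa _
    -- `DG(P,1) = P·G_w + G_z`
    have epair : ∀ G : ℝ × ℝ → ℝ, (fun q : ℝ × ℝ => fderiv ℝ G q (P q, 1)) =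
        fun q => P q * fderiv ℝ G q ((1 : ℝ), (0 : ℝ)) + 1 * fderiv ℝ G q ((0 : ℝ), (1 : ℝ)) := fun G => by
      funext q; rw [fderiv_pair_eq]
    have hdir : ∀ G : ℝ × ℝ → ℝ, AnalyticAt ℝ G (w y, y 2) → AnalyticAt ℝ (fun q : ℝ × ℝ => fderiv ℝ G q (P q, 1)) (w y, y 2) := by
      intro G hG; rw [epair G]
      exact (hPa.mul (analyticAt_fderiv_apply hG _)).add (analyticAt_const.mul (analyticAt_fderiv_apply hG _))
    have hLd' : AnalyticAt ℝ Ld (w y, y 2) := hdir Λ hΛa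
    have hcf' : AnalyticAt ℝ cf (w y, y 2) := hdir P hPa
    have hcd' : AnalyticAt ℝ cd (w y, y 2) := hdir cf hcf'
    have hkd' : AnalyticAt ℝ kd (w y, y 2) := hdir k hka
    have hA₁' : AnalyticAt ℝ A₁ (w y, y 2) := hLd'.add (hΛa.mul hPw')
    have hA₂' : AnalyticAt ℝ A₂ (w y, y 2) :=
      ((hΛa.mul (analyticAt_fderiv_apply hPw' _)).add (hdir Lw hLw')).add ((analyticAt_const.mul hLw').mul hPw')
    have hD₁' : AnalyticAt ℝ D₁ (w y, y 2) := (hΛa.mul hA₂').sub (hLw'.mul hA₁')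
    have h1L : AnalyticAt ℝ (fun q => 1 - Λ q) (w y, y 2) := analyticAt_const.sub hΛa
    have hN' : AnalyticAt ℝ N (w y, y 2) := hΛa.mul h1L
    have hB₁' : AnalyticAt ℝ B₁ (w y, y 2) := ((analyticAt_const.sub (analyticAt_const.mul hΛa)).mul hLd').add (hN'.mul hPw')
    have hB₂' : AnalyticAt ℝ B₂ (w y, y 2) := ((hN'.mul hΛa).add (hdir Lw hLw')).add ((analyticAt_const.mul hLw').mul hPw')
    have hD₃' : AnalyticAt ℝ D₃ (w y, y 2) := (hN'.mul hB₂').sub (hLw'.mul hB₁')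
    have hC₀' : AnalyticAt ℝ C₀ (w y, y 2) := (h1L.mul hcf').sub (hΛa.mul hka)
    have hC₁' : AnalyticAt ℝ C₁ (w y, y 2) :=
      (hN'.mul hpta).add ((((hLd'.neg.mul hcf').add (h1L.mul hcd')).sub (hLd'.mul hka)).sub (hΛa.mul hkd'))
    exact ⟨hPw', hLw', hLd', hcf', hcd', hA₁', hA₂', hD₁', hN', hB₁', hB₂', hD₃', hC₀', hkd', hC₁'⟩
  -- abbreviations for the slice quantities
  have hE_def : ∀ y : EuclideanSpace ℝ (Fin 3), (fderiv ℝ (fun x => v s x 2) y (EuclideanSpace.single 0 1)) ^ 2 +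
      (fderiv ℝ (fun x => v s x 2) y (EuclideanSpace.single 1 1)) ^ 2 =
      fderiv ℝ w y (EuclideanSpace.single 0 (1 : ℝ)) ^ 2 + fderiv ℝ w y (EuclideanSpace.single 1 (1 : ℝ)) ^ 2 := fun y => rfl
  -- the derived identities (K1)′ and the dynamic pair, at every point of `U`
  have hK1' : ∀ y ∈ U, A₁ (w y, y 2) *
        (fderiv ℝ (fun y' => fderiv ℝ w y' (EuclideanSpace.single 0 (1 : ℝ))) y (EuclideanSpace.single 0 (1 : ℝ)) +
          fderiv ℝ (fun y' => fderiv ℝ w y' (EuclideanSpace.single 1 (1 : ℝ))) y (EuclideanSpace.single 1 (1 : ℝ))) +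
      A₂ (w y, y 2) * (fderiv ℝ w y (EuclideanSpace.single 0 (1 : ℝ)) ^ 2 + fderiv ℝ w y (EuclideanSpace.single 1 (1 : ℝ)) ^ 2) +
      cd (w y, y 2) = 0 := by
    intro y hy
    have h := vert_deriv_divIdentity (c := cf) hU hw3 hP2 hΛ2 (fun y' hy' => (hjet y' hy').2.2.2.1.differentiableAt) hP hK1 hy
    simpa [hA₁, hA₂, hcd, hLd, hPw, hLw] using h
  have hcomb : ∀ y ∈ U, N (w y, y 2) * S y + Lw (w y, y 2) *
      (fderiv ℝ w y (EuclideanSpace.single 0 (1 : ℝ)) ^ 2 + fderiv ℝ w y (EuclideanSpace.single 1 (1 : ℝ)) ^ 2) + C₀ (w y, y 2) = 0 := by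
    intro y hy
    have h := dyn_combination (c := cf) (k := k) (S := S) hK1 hV0 hy
    simpa [hN, hC₀, hLw] using h
  have hcomb_raw : ∀ y ∈ U, Λ (w y, y 2) * (1 - Λ (w y, y 2)) * S y +
      fderiv ℝ Λ (w y, y 2) (1, 0) *
        (fderiv ℝ w y (EuclideanSpace.single 0 (1 : ℝ)) ^ 2 + fderiv ℝ w y (EuclideanSpace.single 1 (1 : ℝ)) ^ 2) +
      ((1 - Λ (w y, y 2)) * cf (w y, y 2) - Λ (w y, y 2) * k (w y, y 2)) = 0 := fun y hy =>
    dyn_combination (c := cf) (k := k) (S := S) hK1 hV0 hy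
  have hcomb' : ∀ y ∈ U, B₁ (w y, y 2) * S y +
      B₂ (w y, y 2) * (fderiv ℝ w y (EuclideanSpace.single 0 (1 : ℝ)) ^ 2 + fderiv ℝ w y (EuclideanSpace.single 1 (1 : ℝ)) ^ 2) +
      C₁ (w y, y 2) = 0 := by
    intro y hy
    have h := vert_deriv_dynIdentity (c := cf) (k := k) (S := S) (pt := pt) hU hw2 hPd hΛ2
      (fun y' hy' => (hjet y' hy').2.2.2.1.differentiableAt) (fun y' hy' => (hkA y' hy').differentiableAt) hSd hP hSz hcomb_raw hy
    simpa [hB₁, hB₂, hC₁, hN, hLd, hPw, hLw, hcd, hkd] using h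
  -- THE DICHOTOMY
  by_cases hcase : ∃ y₂ ∈ U, D₁ (w y₂, y₂ 2) ≠ 0 ∨ D₃ (w y₂, y₂ 2) ≠ 0
  · obtain ⟨y₂, hy₂, hD⟩ := hcase
    rcases hD with hD1 | hD3
    · -- Branch 1: Cramer on (K1), (K1)′ near `y₂`
      set A : ℝ × ℝ → ℝ := fun q => (A₁ q * cf q - Λ q * cd q) / D₁ q with hA
      set B : ℝ × ℝ → ℝ := fun q => (Lw q * cd q - A₂ q * cf q) / D₁ q with hB
      -- the open set where `D₁ ≠ 0`
      have hDc : ContinuousOn (fun y => D₁ (w y, y 2)) U := fun y hy =>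
        ((hjet y hy).2.2.2.2.2.2.2.1.continuousAt.comp (f := fun y' : EuclideanSpace ℝ (Fin 3) => (w y', y' 2))
          hleaf.continuousAt).continuousWithinAt
      obtain ⟨O, hOo, hUO, hOsub⟩ : ∃ O : Set (EuclideanSpace ℝ (Fin 3)), IsOpen O ∧ y₂ ∈ O ∧ ∀ y ∈ O, y ∈ U ∧ D₁ (w y, y 2) ≠ 0 := by
        have hev : ∀ᶠ y in 𝓝 y₂, y ∈ U ∧ D₁ (w y, y 2) ≠ 0 := by
          have h1 : ∀ᶠ y in 𝓝 y₂, y ∈ U := hU.mem_nhds hy₂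
          have h2 : ContinuousAt (fun y => D₁ (w y, y 2)) y₂ := (hDc y₂ hy₂).continuousAt (hU.mem_nhds hy₂)
          exact h1.and (h2.eventually_ne hD1)
        obtain ⟨O, hO, hOo, hyO⟩ := _root_.mem_nhds_iff.mp hev
        exact ⟨O, hOo, hyO, fun y hy => hO hy⟩
      refine regular_of_leafwise_near hrate hcont hmild hdiv hpol hs hOo hUO (P := P) (A := A) (B := B)
        (fun y hy => hPA y (hOsub y hy).1) (fun y hy => hP y (hOsub y hy).1) (fun y hy => hnd y (hOsub y hy).1) ?_ ?_
        (fun y hy => ?_) (fun y hy => ?_)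
      · obtain ⟨_, hLw', _, hcf', hcd', hA₁', hA₂', hD₁', -⟩ := hjet y₂ hy₂
        exact ((hA₁'.mul hcf').sub ((hΛA y₂ hy₂).mul hcd')).div hD₁' hD1
      · obtain ⟨_, hLw', _, hcf', hcd', hA₁', hA₂', hD₁', -⟩ := hjet y₂ hy₂
        exact ((hLw'.mul hcd').sub (hA₂'.mul hcf')).div hD₁' hD1
      · have hyU := (hOsub y hy).1; have hDne := (hOsub y hy).2
        have h1 := hK1 y hyU; have h2 := hK1' y hyU
        rw [hE_def]
        simp only [hA]
        rw [eq_div_iff hDne]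
        simp only [hD₁, hA₁, hLd, hLw, hPw] at h1 h2 ⊢
        linear_combination Λ (w y, y 2) * h2 - (fderiv ℝ Λ (w y, y 2) (P (w y, y 2), 1) + Λ (w y, y 2) * fderiv ℝ P (w y, y 2) (1, 0)) * h1
      · have hyU := (hOsub y hy).1; have hDne := (hOsub y hy).2
        have h1 := hK1 y hyU; have h2 := hK1' y hyU
        show fderiv ℝ (fun y' => fderiv ℝ w y' (EuclideanSpace.single 0 (1 : ℝ))) y (EuclideanSpace.single 0 (1 : ℝ)) +
          fderiv ℝ (fun y' => fderiv ℝ w y' (EuclideanSpace.single 1 (1 : ℝ))) y (EuclideanSpace.single 1 (1 : ℝ)) = B (w y, y 2)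
        simp only [hB]
        rw [eq_div_iff hDne]
        simp only [hD₁, hA₁, hA₂, hLd, hLw, hPw] at h1 h2 ⊢
        linear_combination (Λ (w y, y 2) * fderiv ℝ Pw (w y, y 2) (1, 0) + fderiv ℝ Lw (w y, y 2) (P (w y, y 2), 1) +
            2 * fderiv ℝ Λ (w y, y 2) (1, 0) * fderiv ℝ P (w y, y 2) (1, 0)) * h1 - fderiv ℝ Λ (w y, y 2) (1, 0) * h2
    · -- Branch 2a: Cramer on the dynamic pair near `y₂`, then `Δₕw` from (K1)
      set A : ℝ × ℝ → ℝ := fun q => (B₁ q * C₀ q - N q * C₁ q) / D₃ q with hA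
      set B : ℝ × ℝ → ℝ := fun q => -(Lw q * A q + cf q) / Λ q with hB
      have hDc : ContinuousOn (fun y => D₃ (w y, y 2)) U := fun y hy =>
        ((hjet y hy).2.2.2.2.2.2.2.2.2.2.2.1.continuousAt.comp (f := fun y' : EuclideanSpace ℝ (Fin 3) => (w y', y' 2))
          hleaf.continuousAt).continuousWithinAt
      obtain ⟨O, hOo, hUO, hOsub⟩ : ∃ O : Set (EuclideanSpace ℝ (Fin 3)), IsOpen O ∧ y₂ ∈ O ∧ ∀ y ∈ O, y ∈ U ∧ D₃ (w y, y 2) ≠ 0 := by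
        have hev : ∀ᶠ y in 𝓝 y₂, y ∈ U ∧ D₃ (w y, y 2) ≠ 0 := by
          have h1 : ∀ᶠ y in 𝓝 y₂, y ∈ U := hU.mem_nhds hy₂
          have h2 : ContinuousAt (fun y => D₃ (w y, y 2)) y₂ := (hDc y₂ hy₂).continuousAt (hU.mem_nhds hy₂)
          exact h1.and (h2.eventually_ne hD3)
        obtain ⟨O, hO, hOo, hyO⟩ := _root_.mem_nhds_iff.mp hev
        exact ⟨O, hOo, hyO, fun y hy => hO hy⟩
      have hAan : AnalyticAt ℝ A (w y₂, y₂ 2) := by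
        obtain ⟨_, hLw', _, hcf', _, _, _, _, hN', hB₁', _, hD₃', hC₀', _, hC₁'⟩ := hjet y₂ hy₂
        exact ((hB₁'.mul hC₀').sub (hN'.mul hC₁')).div hD₃' hD3
      refine regular_of_leafwise_near hrate hcont hmild hdiv hpol hs hOo hUO (P := P) (A := A) (B := B)
        (fun y hy => hPA y (hOsub y hy).1) (fun y hy => hP y (hOsub y hy).1) (fun y hy => hnd y (hOsub y hy).1) hAan ?_
        (fun y hy => ?_) (fun y hy => ?_)
      · obtain ⟨_, hLw', _, hcf', -⟩ := hjet y₂ hy₂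
        exact ((hLw'.mul hAan).add hcf').neg.div (hΛA y₂ hy₂) (hL0 y₂ hy₂)
      · have hyU := (hOsub y hy).1; have hDne := (hOsub y hy).2
        have h1 := hcomb y hyU; have h2 := hcomb' y hyU
        rw [hE_def]
        simp only [hA]
        rw [eq_div_iff hDne]
        simp only [hD₃]
        linear_combination N (w y, y 2) * h2 - B₁ (w y, y 2) * h1
      · have hyU := (hOsub y hy).1; have hDne := (hOsub y hy).2
        have h1 := hcomb y hyU; have h2 := hcomb' y hyU; have h0 := hK1 y hyU
        have hL := hL0 y hyU
        -- first `E = A`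
        have hEA : fderiv ℝ w y (EuclideanSpace.single 0 (1 : ℝ)) ^ 2 + fderiv ℝ w y (EuclideanSpace.single 1 (1 : ℝ)) ^ 2 = A (w y, y 2) := by
          simp only [hA]
          rw [eq_div_iff hDne]
          simp only [hD₃]
          linear_combination N (w y, y 2) * h2 - B₁ (w y, y 2) * h1
        show fderiv ℝ (fun y' => fderiv ℝ w y' (EuclideanSpace.single 0 (1 : ℝ))) y (EuclideanSpace.single 0 (1 : ℝ)) +
          fderiv ℝ (fun y' => fderiv ℝ w y' (EuclideanSpace.single 1 (1 : ℝ))) y (EuclideanSpace.single 1 (1 : ℝ)) = B (w y, y 2)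
        simp only [hB]
        rw [eq_div_iff hL, ← hEA]
        simp only [hLw]
        linear_combination h0
  · -- Branch 2b: both Wronskians vanish identically on `U`
    push Not at hcase
    have hD1z : ∀ y ∈ U, D₁ (w y, y 2) = 0 := fun y hy => (hcase y hy).1
    have hD3z : ∀ y ∈ U, D₃ (w y, y 2) = 0 := fun y hy => (hcase y hy).2
    -- a horizontal direction with `∂_b w(y₁) ≠ 0`, and the open set where it stays non-zero
    have hmain : ∀ b : Fin 3, b ≠ 2 → fderiv ℝ w y₁ (EuclideanSpace.single b (1 : ℝ)) ≠ 0 → False := by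
      intro b hb hb0
      have hcb : Continuous (fun y => fderiv ℝ w y (EuclideanSpace.single b (1 : ℝ))) :=
        (contDiff_two_partial (hwA.contDiff) _).continuous
      set U' : Set (EuclideanSpace ℝ (Fin 3)) := U ∩ {y | fderiv ℝ w y (EuclideanSpace.single b (1 : ℝ)) ≠ 0} with hU'
      have hU'o : IsOpen U' := hU.inter (isOpen_ne_fun hcb continuous_const)
      have hy₁' : y₁ ∈ U' := ⟨hy₁, hb0⟩
      exact branch2b_false_of_divIdentity (U := U') (w := w) (P := P) (Λ := Λ) hU'o hy₁' hb hwA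
        (fun y hy => hPA y hy.1) (fun y hy => hΛA y hy.1) (fun y hy => hP y hy.1) (fun y hy => hy.2)
        (fun y hy => hL0 y hy.1) (fun y hy => hL1 y hy.1) (fun y hy => hK1 y hy.1)
        (fun y hy => by have := hD1z y hy.1; simpa [hD₁, hA₁, hA₂, hLd, hLw, hPw] using this)
        (fun y hy => by have := hD3z y hy.1; simpa [hD₃, hB₁, hB₂, hN, hLd, hLw, hPw] using this)
    exfalso
    rcases hnd y₁ hy₁ with h0 | h1
    · exact hmain 0 (by decide) h0
    · exact hmain 1 (by decide) h1

end Summit.NavierStokesRegularity.NavierStokesRegularity.Theorems.PoloidalWindowDoorPoloidalWindowRigidityUntwistedAssemblyCore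

end
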